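import Literature.AnabelianGeometry.SemiGraphs.PSCThreeChainShape
import Literature.AnabelianGeometry.SemiGraphs.ProSigmaCuspInertiaDisjoint
import HarnessLib

/-!
# [CombGC] Prop. 1.2 (i)(ii) and Prop. 1.5 (i) at GENUINE THREE-COMPONENT CHAIN data (two nodes)

Mochizuki, *A combinatorial version of the Grothendieck conjecture* [CombGC] §1, Prop. 1.2 (i)(ii) p. 8 and
Prop. 1.5 (i) p. 12 [cite: MochizukiCombGC2007, Prop 1.2(i) p.8] [cite: MochizukiCombGC2007, Prop 1.2(ii) p.8]
[cite: MochizukiCombGC2007, Prop 1.5(i) p.12].  PROOF-ONLY file (abc-iut-f-164 gen 3; abc-iut FACT-LIST rows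
F-0459 `PSCDatum.OpenInterDeterminesComponentHolds`, F-0438 `PSCDatum.CommensurableTerminalityHolds`, F-0440
`PSCDatum.EdgeLikeIncidenceHolds` — schemata over `Ω : PSCOrigin`, universal closures refuted, instance forms
the content).  The data of THREE-COMPONENT CHAIN SHAPE (`PSCThreeChainShape.lean`: a pointed stable curve
`C₀ ∪_{ν_A} C_mid ∪_{ν_B} C₁`, TWO nodes, three vertices, arbitrary genera, at least two cusps on each
component; `Π` any profinite pro-`Σ` completion of `Γ_{g,r}`) are the first genuine carrier with MORE THAN
ONE NODE at which these rows are settled in the kernel — entirely by free-factor geometry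
(`threeChain_freeFactor_package`), without characters:

ONE theorem `threeChain_rows` with five conjuncts: (1) F-0438, first clause
(`VerticialEdgeLikeCommensurablyTerminal`); (2)(3) F-0459, verticial and edge-like clauses (abc-iut-L5-t6's
criteria `…_of`; node/node, node/cusp by free factors, cusp/cusp by `cuspInertia_closure_inf_conj_eq_bot_of_ne`);
(4) **F-0440 (`EdgeLikeIncidence`): each node group lies in EXACTLY TWO of the THREE verticial
representatives' conjugacy classes** (`ν_A` in `Π_{v₀}`, `Π_{v_mid}`; `ν_B` in `Π_{v_mid}`, `Π_{v₁}`), each cusp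
group in exactly one; (5) the distinct-branch-overgroups link for both nodes (input of abc-iut-w4-d081's
Prop. 1.5 (ii) reduction).

The sturdy `Π^unr`-clauses are not treated (vacuous at origins with a genus-`< 2` component:
`PSCThreeChainOrigin.lean`).  Shape instances are consistency evidence for the typed schemata, not the printed
theorems for all pointed stable curves.  0 definitions; nothing here takes a side on [IUTchIII] Cor. 3.12.
-/

noncomputable section

namespace Literature.AnabelianGeometry.SemiGraphs

namespace PSCDatum

open scoped Pointwise
open Literature.GroupTheory.CombinatorialGroupTheory
open SemiGraphOfAnabelioids (IsProSigmaCompletion infinite_cuspInertia_closure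
  cuspInertia_closure_isCommensurablyTerminal cuspInertia_closure_inf_conj_eq_bot_of_ne)

universe u

variable {P : Type u} [Group P] [TopologicalSpace P] [IsTopologicalGroup P]
variable [CompactSpace P] [T2Space P] [TotallyDisconnectedSpace P] {Sigma : Set ℕ} {g r : ℕ}

omit [TopologicalSpace P] [IsTopologicalGroup P] [CompactSpace P] [T2Space P]
  [TotallyDisconnectedSpace P] in
/-- An infinite subgroup is not trivial. [cite: MochizukiCombGC2007, Rmk 1.1.3 p.7] -/
private theorem ne_bot_of_infinite₄ {H : Subgroup P} (h : Infinite H) : H ≠ ⊥ := by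
  rintro rfl
  exact h.not_finite inferInstance

/-- **[CombGC] Prop. 1.2 (ii) (first clause), Prop. 1.2 (i) (verticial and edge-like clauses) and Prop. 1.5
(i) at every datum of three-component chain shape**, together with the branch links of both nodes — fed
from `threeChain_freeFactor_package` into abc-iut-L5-t6's criteria.  Hypotheses: the shape
(`PSCThreeChainShape.lean`). [cite: MochizukiCombGC2007, Prop 1.5(i) p.12]
[cite: MochizukiCombGC2007, Prop 1.2(i) p.8] [cite: MochizukiCombGC2007, Prop 1.2(ii) p.8] -/
theorem threeChain_rows (hne : Sigma.Nonempty)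
    (hprime : ∀ p ∈ Sigma, p.Prime) (ι : PuncturedSurfaceGroup g r →* P)
    (hι : IsProSigmaCompletion Sigma ι) (G : PSCDatum P) {g₀ g₁ s₁ s₂ : ℕ} (hg : g₀ ≤ g₁) (hs₁ : 2 ≤ s₁)
    (hs₁₂ : s₁ + 2 ≤ s₂) (hs₂ : s₂ + 2 ≤ r) (e : G.graph.C ≃ Fin r)
    (hC : ∀ c, G.cuspGp c =
      ((PuncturedSurfaceGroup.cuspInertia (g := g) (e c)).map ι).topologicalClosure)
    (v₀ vm v₁ : G.graph.V) (hV : ∀ w, w = v₀ ∨ w = vm ∨ w = v₁) (εA η : PuncturedSurfaceGroup g r)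
    (hεA : εA = ((List.finRange r).map fun j : Fin r =>
          if s₂ ≤ (j : ℕ) then PuncturedSurfaceGroup.c (g := g) j else 1).prod *
        ((List.finRange g).map fun i : Fin g => if (i : ℕ) < g₀ then
          PuncturedSurfaceGroup.a (r := r) i * PuncturedSurfaceGroup.b i *
            (PuncturedSurfaceGroup.a i)⁻¹ * (PuncturedSurfaceGroup.b i)⁻¹ else 1).prod)
    (hη : η = ((List.finRange r).map fun j : Fin r =>
          if s₁ ≤ (j : ℕ) then PuncturedSurfaceGroup.c (g := g) j else 1).prod *
        ((List.finRange g).map fun i : Fin g => if (i : ℕ) < g₁ then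
          PuncturedSurfaceGroup.a (r := r) i * PuncturedSurfaceGroup.b i *
            (PuncturedSurfaceGroup.a i)⁻¹ * (PuncturedSurfaceGroup.b i)⁻¹ else 1).prod)
    (hV₀ : G.vertGp v₀ = ((Subgroup.closure {x : PuncturedSurfaceGroup g r |
        (∃ i : Fin g, (i : ℕ) < g₀ ∧ (x = PuncturedSurfaceGroup.a i ∨ x = PuncturedSurfaceGroup.b i)) ∨
        ∃ j : Fin r, s₂ ≤ (j : ℕ) ∧ x = PuncturedSurfaceGroup.c j}).map ι).topologicalClosure)
    (hVm : G.vertGp vm = ((Subgroup.closure {x : PuncturedSurfaceGroup g r |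
        (∃ i : Fin g, (g₀ ≤ (i : ℕ) ∧ (i : ℕ) < g₁) ∧
          (x = PuncturedSurfaceGroup.a i ∨ x = PuncturedSurfaceGroup.b i)) ∨
        (∃ j : Fin r, (s₁ ≤ (j : ℕ) ∧ (j : ℕ) < s₂) ∧ x = PuncturedSurfaceGroup.c j) ∨
        x = εA ∨ x = η}).map ι).topologicalClosure)
    (hV₁ : G.vertGp v₁ = ((Subgroup.closure {x : PuncturedSurfaceGroup g r |
        (∃ i : Fin g, g₁ ≤ (i : ℕ) ∧ (x = PuncturedSurfaceGroup.a i ∨ x = PuncturedSurfaceGroup.b i)) ∨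
        (∃ j : Fin r, (j : ℕ) < s₁ ∧ x = PuncturedSurfaceGroup.c j) ∨ x = η}).map ι).topologicalClosure)
    (nA nB : G.graph.N) (hN : ∀ n, n = nA ∨ n = nB)
    (hEA : G.nodeGp nA = ((Subgroup.zpowers εA).map ι).topologicalClosure)
    (hEB : G.nodeGp nB = ((Subgroup.zpowers η).map ι).topologicalClosure)
    (hendsA : G.graph.nodeEnds nA = s(v₀, vm)) (hendsB : G.graph.nodeEnds nB = s(vm, v₁)) :
    G.VerticialEdgeLikeCommensurablyTerminal ∧ G.VerticialOpenInterDeterminesVertex ∧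
      G.EdgeLikeOpenInterDeterminesEdge ∧ G.EdgeLikeIncidence ∧
      (∀ n : G.graph.N, ∃ (w₁ w₂ : G.graph.V) (γ₁ γ₂ : ConjAct P),
        G.graph.nodeEnds n = s(w₁, w₂) ∧ γ₁ • G.nodeGp n ≤ G.vertGp w₁ ∧
          γ₂ • G.nodeGp n ≤ G.vertGp w₂ ∧ γ₁⁻¹ • G.vertGp w₁ ≠ γ₂⁻¹ • G.vertGp w₂) := by
  classical
  have hhyp : PuncturedSurfaceGroup.IsHyperbolicType g r := by
    unfold PuncturedSurfaceGroup.IsHyperbolicType; omega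
  have h3 : 3 ≤ r := by omega
  obtain ⟨hvt, hnt, hmal, hninf, hNC, hNN, hsepV, ⟨hA0, hAm, hA1, hBm, hB1, hB0⟩, hCend,
    ⟨hv0m, hvm1, hv01, hnAB⟩, -, -⟩ :=
    G.threeChain_freeFactor_package hne hprime ι hι hg hs₁ hs₁₂ hs₂ e hC v₀ vm v₁ hV εA η hεA hη hV₀ hVm
      hV₁ nA nB hN hEA hEB
  have hcinf : ∀ c, Infinite (G.cuspGp c) := fun c => by
    rw [hC]; exact infinite_cuspInertia_closure hne hprime hhyp ι hι (e c)
  -- pairwise everywhere-disjointness of distinct edge groups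
  have hsepE : ∀ e₁ e₂ : G.graph.N ⊕ G.graph.C, e₁ ≠ e₂ →
      ∀ x : P, G.edgeGp e₁ ⊓ ConjAct.toConjAct x • G.edgeGp e₂ = ⊥ := by
    rintro (n₁ | c₁) (n₂ | c₂) hne12 x
    · change G.nodeGp n₁ ⊓ ConjAct.toConjAct x • G.nodeGp n₂ = ⊥
      rcases hN n₁ with rfl | rfl <;> rcases hN n₂ with rfl | rfl
      · exact absurd rfl hne12
      · exact hNN x
      · exact inf_conj_eq_bot_symm hNN x
      · exact absurd rfl hne12
    · exact hNC n₁ c₂ x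
    · exact inf_conj_eq_bot_symm (hNC n₂ c₁) x
    · have hc12 : e c₁ ≠ e c₂ := fun h => hne12 (by rw [e.injective h])
      change G.cuspGp c₁ ⊓ ConjAct.toConjAct x • G.cuspGp c₂ = ⊥
      rw [hC, hC]
      exact cuspInertia_closure_inf_conj_eq_bot_of_ne h3 ι hι hc12 x
  refine ⟨G.verticialEdgeLikeCommensurablyTerminal_of hvt hnt (fun c => ?_),
    G.verticialOpenInterDeterminesVertex_of hsepV,
    G.edgeLikeOpenInterDeterminesEdge_of (fun e' => ?_) hsepE,
    G.edgeLikeIncidence_of hmal (fun n => ne_bot_of_infinite₄ (hninf n))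
      (fun c => ne_bot_of_infinite₄ (hcinf c)) hNC (fun n => ?_) hCend,
    fun n => ?_⟩
  · rw [hC]; exact cuspInertia_closure_isCommensurablyTerminal hne hprime hhyp ι hι (e c)
  · rcases e' with n | c
    · exact hninf n
    · exact hcinf c
  · -- the two verticial overgroups of each node
    rcases hN n with rfl | rfl
    · refine ⟨v₀, vm, hA0, hAm, hv0m, fun w hw₀ hwm x => ?_⟩
      rcases hV w with rfl | rfl | rfl
      · exact absurd rfl hw₀
      · exact absurd rfl hwm
      · exact hA1 x
    · refine ⟨vm, v₁, hBm, hB1, hvm1, fun w hwm hw₁ x => ?_⟩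
      rcases hV w with rfl | rfl | rfl
      · exact hB0 x
      · exact absurd rfl hwm
      · exact absurd rfl hw₁
  · -- branch links with trivial conjugators
    rcases hN n with rfl | rfl
    · refine ⟨v₀, vm, 1, 1, hendsA, ?_, ?_, ?_⟩
      · rw [one_smul]; exact hA0
      · rw [one_smul]; exact hAm
      · rwa [inv_one, one_smul, one_smul]
    · refine ⟨vm, v₁, 1, 1, hendsB, ?_, ?_, ?_⟩
      · rw [one_smul]; exact hBm
      · rw [one_smul]; exact hB1
      · rwa [inv_one, one_smul, one_smul]

end PSCDatum

end Literature.AnabelianGeometry.SemiGraphs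

end
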